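/-
Copyright: lit-balaban Phase-2 proof seat p30 (gen 3).  Statement-level skeleton of a published paper; no proof claims beyond what
the kernel checks below.
-/
import Literature.MathematicalPhysics.QuantumFieldTheory.BalabanImbrieJaffe1984to88.BIJ85CurlQsstar
import Literature.MathematicalPhysics.QuantumFieldTheory.BalabanImbrieJaffe1984to88.BIJ85Eq219ProofPart2
import Literature.MathematicalPhysics.QuantumFieldTheory.BalabanImbrieJaffe1984to88.BIJ85AxialPropagator411

/-!
# `BalabanImbrieJaffe1984to88.BIJ85Eq531Inputs` — T. Bałaban, J. Imbrie, A. Jaffe, *Renormalization of the Higgs model: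
minimizers, propagators and the stability of mean field theory*, Commun. Math. Phys. **97** (1985) 299–329
[BalabanImbrieJaffe1985]: the two "facts" and the translation used to derive **(5.3.1)** p. 317 —
`Q_kQ^{s*}_k = I`, `δ_{k,Ax}(Q^{s*}_kB)`, `∂Q^{s*}_k = Q^{e*}_k∂` — for the k-fold operators on the tori of the series

statement-level skeleton of published theorems with citation tags; proofs where landed; nothing here is a claim about the Yang–Mills mass gap

PDF held: `paper:balaban1985-cmp97-bij-higgs-minimizers` (journal page = PDF page + 298).  Pages read as images:
`run/shared/lean/pub/lit-balaban/lit-balaban-r15/pages/1985-cmp97-bij-higgs-minimizers-p007-x2.png` (p. 305, (2.19)–(2.24)),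
`…-p019-x2.png` (p. 317, (5.3.1)), `run/shared/lean/pub/pub-balaban/t4/b2b-balaban-t4-lit2/renders/bij1985/…-p025-x2.png`
(p. 323, (7.1.18)).

CITATION HEADER (lean-in-tree rule).  Part of the lit-balaban TYPED SKELETON (HOME `run/shared/lean/pub/lit-balaban/`), Phase-2
seat p30 (gen 3); row **C1.Eq5.3.1** of `HOME/SKELETON.md` (reader file `HOME/lit-balaban-r15/ROWS-C1.md`), whose Gaussian part
(`H_{k,Ax}B = A₀ − G_{k,Ax}∂^*∂A₀` for any representative `A₀`, `eq531_shape`) is seat p09's `BIJ85AxialMinimizer413`, and rows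
**C1.Eq2.24** (the k-fold operators) / **C1.Eq4.3.1-4.3.3** ((4.3.2) uses the same translation).  WHAT IS REPRODUCED, and how.
p. 317 [PDF 19], verbatim: *"To help define the fluctuation field in the (k+1)st step, we need one more identity, namely
H_{k,Ax}B = Q^{s*}_kB − G_{k,Ax}∂^*Q^{e*}_k∂B. (5.3.1) This identity follows by inspecting the definition (4.1.3) after the
translation A = A′ + Q^{s*}_kB. Use the facts Q_kQ^{s*}_k = I and ∂Q^{s*}_kB = Q^{e*}_k∂B to obtain
H_{k,Ax}B = Z_{k,Ax}(B)^{−1}∫𝒟A′δ(Q_kA′)δ_{k,Ax}(A′)(A′ + Q^{s*}_kB)exp(−½‖∂A′ + Q^{e*}_k∂B‖²)."*  The operators are the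
k-fold ones of p. 305, verbatim: *"We also need the k-fold averaging operators Q_k ≡ (Q)^k, etc. Especially important are
Q^e_k ≡ (Q^e)^k and Q^s_k = (Q^s)^k"*.  In the tree `Q_k` from the finest torus `T^{(0)}` (`= T_η`) to `T^{(k)}` is the k-fold
COMPOSITE `LatticeFieldCalculus.bondAvgIter k` ([Balaban1984PropagatorsI] (1.18)), the gauge conditions `δ_{k,Ax}` are
`BIJ85AxialPropagator411.deltaAx k` and the domain `δ(Q_kA′)δ_{k,Ax}(A′)` is `BIJ85AxialPropagator411.constraint411 k` (seat p09).
Accordingly `Q^{s*}_k`, `Q^{e*}_k` are typed here as the k-fold COMPOSITES of the one-step operators of the tori — (2.17)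
`BlockBonds.Qsstar` of `BIJ85Eq219Proof.torusBlockBonds` (seat p31) and (2.22) `Cells.Qstar` of `BIJ85CurlQsstar.torusEdgeCells`
(seat p31 gen 2) — from `T^{(k)}` down to `T^{(0)}` (`QsstarIter`, `QestarIter`); the k-fold GEOMETRIC reading (*"(2.13), where L is
replaced by L^k"*, p. 309: block size `L^k`) is seat p31's `BIJ85Eq224Proof.torusBlockBondsIter`, which proves the two agree.  PROVED:
* **`Q_kQ^{s*}_k = I`** (`bondAvgIter_QsstarIter`; one step = (2.19) `BIJ85Eq219Proof.bondAvg_Qsstar`);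
* **`δ_{k,Ax}(Q^{s*}_kB)`**: `Q^{s*}B` vanishes on interior bonds, hence along every staircase `Γ_{y,x}` of the axial gauge
  (`isAxial_Qsstar`, from `BIJ85Eq219ProofPart2.stairSum_eq_zero_of_interior`), and `δ_{k,Ax}(Q^{s*}_kB)` literally
  (`deltaAx_QsstarIter`);
* THE TRANSLATION: `A ↦ A′ = A − Q^{s*}_kB` maps `{A : Q_kA = B, δ_{k,Ax}(A)}` onto `δ(Q_kA′)δ_{k,Ax}(A′)` = `constraint411 k` and
  back (`sub_QsstarIter_mem_constraint411`, `constraint411_add_QsstarIter`) — *"inspecting the definition (4.1.3) after the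
  translation A = A′ + Q^{s*}_kB"*;
* **`∂Q^{s*}_k = Q^{e*}_k∂`** for the composites (`curl_QsstarIter`: fine lattice factor `L^k·c` against coarse factor `c`, by
  iterating seat p31's one-step `BIJ85CurlQsstar.curl_Qsstar`; `curl_QsstarIter_eta` in the units of Sect. 4–5, `η⁻¹ = L^k` on
  `T_η` and `1` on the unit lattice).
Standing range `k ≤ m + K` of `Setup`; `2 ≤ d` for the edge carrier.  NOT here: (5.3.1) itself (= these inputs inserted in p09's
`BIJ85AxialMinimizer413.Hax_eq_minimizer`; a sibling file once that file is in the tree), the k-fold geometry and (2.24) (seat p31).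
Unit `lit-balaban-p30` (literature-prover-lit-balaban-p30-g3-0), 2026-08-21.
-/

open scoped BigOperators

namespace Literature.MathematicalPhysics.QuantumFieldTheory.BalabanImbrieJaffe1984to88.BIJ85Eq531Inputs

open Literature.MathematicalPhysics.QuantumFieldTheory.Balaban1983to89
open BIJ85Sect2SurfaceAverages BIJ85CellAverages LatticeFieldCalculus BIJ85Eq219Proof BIJ85Eq219ProofPart2 BIJ85CurlQsstar
  BIJ85AxialPropagator411

variable {P : Params}

/-! ## 1. The k-fold composites `Q^{s*}_k = (Q^{s*})^k`, `Q^{e*}_k = (Q^{e*})^k` between `T^{(k)}` and `T^{(0)}` -/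

/-- `Q^{s*}_k = (Q^{s*})^k` (p. 305: *"Especially important are Q^e_k ≡ (Q^e)^k and Q^s_k = (Q^s)^k"*): the k-fold surface
pull-back from the bond fields of `T^{(k)}` to those of the finest torus `T^{(0)}`, the composite of the one-step operators (2.17) of
the tori `T^{(i)} ⊃ T^{(i+1)}`, `i < k` — the source of `bondAvgIter k` = Q_k is its target. [cite: BalabanImbrieJaffe1985, (2.24) p.305] -/
noncomputable def QsstarIter : (k : ℕ) → (PBond P k → ℝ) → (PBond P 0 → ℝ)
  | 0 => id
  | k + 1 => fun B => QsstarIter k ((torusBlockBonds P k).Qsstar B)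

/-- `Q^{e*}_k = (Q^{e*})^k`: the k-fold edge pull-back from the plaquette fields of `T^{(k)}` to those of `T^{(0)}`, the composite
of the one-step operators (2.22) of the tori (`2 ≤ d`). [cite: BalabanImbrieJaffe1985, (2.24) p.305] -/
noncomputable def QestarIter (hd : 2 ≤ P.d) : (k : ℕ) → (Plaq P k → ℝ) → (Plaq P 0 → ℝ)
  | 0 => id
  | k + 1 => fun g => QestarIter hd k ((torusEdgeCells P k hd).Qstar g)

/-- `Q^{s*}_0 = I`. [cite: BalabanImbrieJaffe1985, (2.24) p.305] -/
@[simp] theorem QsstarIter_zero (B : PBond P 0 → ℝ) : QsstarIter 0 B = B := rfl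

/-- `Q^{s*}_{k+1} = Q^{s*}_k Q^{s*}`, the last factor acting from `T^{(k+1)}` to `T^{(k)}`. [cite: BalabanImbrieJaffe1985, (2.24) p.305] -/
theorem QsstarIter_succ (k : ℕ) (B : PBond P (k + 1) → ℝ) :
    QsstarIter (k + 1) B = QsstarIter k ((torusBlockBonds P k).Qsstar B) := rfl

/-- `Q^{e*}_0 = I`. [cite: BalabanImbrieJaffe1985, (2.24) p.305] -/
@[simp] theorem QestarIter_zero (hd : 2 ≤ P.d) (g : Plaq P 0 → ℝ) : QestarIter hd 0 g = g := rfl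

/-- `Q^{e*}_{k+1} = Q^{e*}_k Q^{e*}`. [cite: BalabanImbrieJaffe1985, (2.24) p.305] -/
theorem QestarIter_succ (hd : 2 ≤ P.d) (k : ℕ) (g : Plaq P (k + 1) → ℝ) :
    QestarIter hd (k + 1) g = QestarIter hd k ((torusEdgeCells P k hd).Qstar g) := rfl

/-! ## 2. The first fact: `Q_kQ^{s*}_k = I` -/

/-- **`Q_kQ^{s*}_k = I`** — the first "fact" used under (5.3.1) p. 317 [PDF 19] (verbatim: *"Use the facts Q_kQ^{s*}_k = I and
∂Q^{s*}_kB = Q^{e*}_k∂B"*), i.e. (2.19) iterated: on the tori `Q_k(Q^{s*}_kB) = B` with Q_k = `bondAvgIter k` (standing range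
`k ≤ m + K`; one step = p31's `bondAvg_Qsstar`). [cite: BalabanImbrieJaffe1985, (5.3.1) p.317] -/
theorem bondAvgIter_QsstarIter {k : ℕ} (hk : k ≤ P.m + P.K) (B : PBond P k → ℝ) :
    bondAvgIter (V := ℝ) k (QsstarIter k B) = B := by
  induction k with
  | zero => rfl
  | succ k ih =>
    show bondAvg (bondAvgIter (V := ℝ) k (QsstarIter k ((torusBlockBonds P k).Qsstar B))) = B
    rw [ih (by omega), bondAvg_Qsstar (by omega)]

/-! ## 3. The translation `A = A′ + Q^{s*}_kB` keeps the axial gauge: `δ_{k,Ax}(Q^{s*}_kB)` -/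

/-- kernel: `Q^{s*}B` IS AXIAL on `T^{(j)}` — it vanishes on every interior bond ((2.17), second case), in particular on every bond
of the staircase contours `Γ_{y,x}`, `x ∈ B(y)`, of the axial gauge ([Balaban1984PropagatorsI] (1.10); p31's
`stairSum_eq_zero_of_interior`), standing range. [cite: BalabanImbrieJaffe1985, (5.3.1) p.317] -/
theorem isAxial_Qsstar {j : ℕ} (hj : j + 1 ≤ P.m + P.K) (B : PBond P (j + 1) → ℝ) :
    IsAxial (V := ℝ) ((torusBlockBonds P j).Qsstar B) :=
  fun y r _ => stairSum_eq_zero_of_interior hj y (fun _ h1 h2 => Qsstar_of_interior B (h1.trans h2.symm)) r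

/-- **`δ_{k,Ax}(Q^{s*}_kB)`** ((4.1.2): `δ_{k,Ax}(A) = Π_{i<k} δ_{Ax}(Q_iA)`, `BIJ85AxialPropagator411.deltaAx`): for every `i < k` the
field `Q_i(Q^{s*}_kB) = Q^{s*}_{k−i}`-of-`B` on `T^{(i)}` is axial — so the translation `A = A′ + Q^{s*}_kB` of p. 317 turns
`δ_{k,Ax}(A)` into `δ_{k,Ax}(A′)` (standing range `k ≤ m + K`). [cite: BalabanImbrieJaffe1985, (5.3.1) p.317] -/
theorem deltaAx_QsstarIter {k : ℕ} (hk : k ≤ P.m + P.K) (B : PBond P k → ℝ) : deltaAx k (QsstarIter k B) := by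
  induction k with
  | zero => exact deltaAx_zero _
  | succ k ih =>
    rw [deltaAx_succ]
    refine ⟨ih (by omega) ((torusBlockBonds P k).Qsstar B), ?_⟩
    show IsAxial (bondAvgIter (V := ℝ) k (QsstarIter k ((torusBlockBonds P k).Qsstar B)))
    rw [bondAvgIter_QsstarIter (by omega)]
    exact isAxial_Qsstar (by omega) B

/-- THE TRANSLATION of p. 317, verbatim: *"This identity follows by inspecting the definition (4.1.3) after the translation
A = A′ + Q^{s*}_kB"* — if `Q_kA = B` and `δ_{k,Ax}(A)` then `A′ = A − Q^{s*}_kB` lies in the domain `δ(Q_kA′)δ_{k,Ax}(A′)` of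
(4.1.1) (`constraint411 k`; standing range). [cite: BalabanImbrieJaffe1985, (5.3.1) p.317] -/
theorem sub_QsstarIter_mem_constraint411 {k : ℕ} (hk : k ≤ P.m + P.K) {A : VecField P 0 ℝ} {B : PBond P k → ℝ}
    (hQ : bondAvgIter k A = B) (hAx : deltaAx k A) :
    A - QsstarIter k B ∈ (constraint411 k : Submodule ℝ (VecField P 0 ℝ)) := by
  have hsub : A - QsstarIter k B = A + (-1 : ℝ) • QsstarIter k B := by
    rw [neg_one_smul, sub_eq_add_neg]
  rw [mem_constraint411, hsub]
  refine ⟨?_, fun i hi => ?_⟩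
  · rw [bondAvgIter_add, bondAvgIter_smul, hQ, bondAvgIter_QsstarIter hk, neg_one_smul, add_neg_cancel]
  · rw [bondAvgIter_add, bondAvgIter_smul]
    exact isAxial_add (hAx i hi) (isAxial_smul _ (deltaAx_QsstarIter hk B i hi))

/-- THE TRANSLATION of p. 317, converse direction: for `A′` in the domain `δ(Q_kA′)δ_{k,Ax}(A′)` the translate `A = A′ + Q^{s*}_kB`
has `Q_kA = B` and `δ_{k,Ax}(A)` — the integrand substitution `δ(Q_kA − B)δ_{k,Ax}(A) ↦ δ(Q_kA′)δ_{k,Ax}(A′)` displayed after (5.3.1)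
(standing range). [cite: BalabanImbrieJaffe1985, (5.3.1) p.317] -/
theorem constraint411_add_QsstarIter {k : ℕ} (hk : k ≤ P.m + P.K) {A' : VecField P 0 ℝ}
    (hA' : A' ∈ (constraint411 k : Submodule ℝ (VecField P 0 ℝ))) (B : PBond P k → ℝ) :
    bondAvgIter k (A' + QsstarIter k B) = B ∧ deltaAx k (A' + QsstarIter k B) := by
  obtain ⟨h1, h2⟩ := (mem_constraint411 k A').mp hA'
  refine ⟨?_, fun i hi => ?_⟩
  · rw [bondAvgIter_add, h1, bondAvgIter_QsstarIter hk, zero_add]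
  · rw [bondAvgIter_add]
    exact isAxial_add (h2 i hi) (deltaAx_QsstarIter hk B i hi)

/-- `Q^{s*}_kB` itself is a representative of the constraint class of `B`: `Q_k(Q^{s*}_kB) = B` and `δ_{k,Ax}(Q^{s*}_kB)` — the
`A₀` to which p09's `BIJ85AxialMinimizer413.Hax_eq_minimizer` / `eq531_shape` apply (standing range).
[cite: BalabanImbrieJaffe1985, (5.3.1) p.317] -/
theorem QsstarIter_representative {k : ℕ} (hk : k ≤ P.m + P.K) (B : PBond P k → ℝ) :
    bondAvgIter k (QsstarIter k B) = B ∧ deltaAx k (QsstarIter k B) :=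
  ⟨bondAvgIter_QsstarIter hk B, deltaAx_QsstarIter hk B⟩

/-! ## 4. The second fact: `∂Q^{s*}_k = Q^{e*}_k∂` for the k-fold composites -/

/-- **`∂Q^{s*}_k = Q^{e*}_k∂`** — the second "fact" used under (5.3.1) p. 317 (*"∂Q^{s*}_kB = Q^{e*}_k∂B"*) and in (7.1.18) p. 323
(*"Furthermore Q^{e*}_k∂ = ∂Q^{s*}_k"*), for the k-fold composites on the tori, by iterating seat p31's one-step
`BIJ85CurlQsstar.curl_Qsstar`: with the coarse lattice factor `c` on `T^{(k)}` and the fine factor `L^k·c` on `T^{(0)}`,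
`∂_{L^kc}(Q^{s*}_kB) = Q^{e*}_k(∂_cB)` (standing range `k ≤ m + K`, `2 ≤ d`). [cite: BalabanImbrieJaffe1985, (5.3.1) p.317] -/
theorem curl_QsstarIter (hd : 2 ≤ P.d) {k : ℕ} (hk : k ≤ P.m + P.K) (c : ℝ) (B : PBond P k → ℝ) :
    curl ((P.L : ℝ) ^ k * c) (QsstarIter k B) = QestarIter hd k (curl c B) := by
  induction k generalizing c with
  | zero => simp
  | succ k ih =>
    rw [QsstarIter_succ, QestarIter_succ, pow_succ, mul_assoc, ih (by omega), curl_Qsstar (by omega) hd]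

/-- `∂Q^{s*}_k = Q^{e*}_k∂` in the units of Sects. 4–5: `T^{(0)} = T_η` with `∂` carrying the factor `η⁻¹ = L^k`, the unit lattice
`T^{(k)}` with factor `1` — `∂(Q^{s*}_kB) = Q^{e*}_k(∂B)` (standing range, `2 ≤ d`). [cite: BalabanImbrieJaffe1985, (7.1.18) p.323] -/
theorem curl_QsstarIter_eta (hd : 2 ≤ P.d) {k : ℕ} (hk : k ≤ P.m + P.K) (B : PBond P k → ℝ) :
    curl ((P.L : ℝ) ^ k) (QsstarIter k B) = QestarIter hd k (curl 1 B) := by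
  rw [← curl_QsstarIter hd hk 1 B, mul_one]

/-- The pointwise form of `∂Q^{s*}_k = Q^{e*}_k∂` (plaquette by plaquette). [cite: BalabanImbrieJaffe1985, (5.3.1) p.317] -/
theorem curl_QsstarIter_apply (hd : 2 ≤ P.d) {k : ℕ} (hk : k ≤ P.m + P.K) (c : ℝ) (B : PBond P k → ℝ) (p : Plaq P 0) :
    curl ((P.L : ℝ) ^ k * c) (QsstarIter k B) p = QestarIter hd k (curl c B) p := by
  rw [curl_QsstarIter hd hk]

end Literature.MathematicalPhysics.QuantumFieldTheory.BalabanImbrieJaffe1984to88.BIJ85Eq531Inputs
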